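import Summits.ResolutionOfSingularities.ResolutionOfSingularities.Theorems.FrobeniusLadderFInjectiveMacaulayficationRelGddF008Data
import Summits.ResolutionOfSingularities.ResolutionOfSingularities.Theorems.FrobeniusLadderFInjectiveMacaulayficationRelGddF008ConeData
import HarnessLib

/-!
# RGDD-L row F008 at `p = 5` — the CONE CLAUSE `hoff₀`: the weighted tangent cone `g₀ = z² + t⁴w⁶ + (y² + x³)³ + t·x³y·w³` along the
# `t`-axis is FULL at every closed point off `V(x,y,z,w)` (Jacobian off `S ∪ W`, Fedder through three slicings along the cusp surface
# `S = V(z, w, y² + x³)` and the `w`-axis `W = V(x, y, z, t)`)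
# (crux `FInjectiveMacaulayfication` stmt-ResolutionOfSingularities-15315, relative filtered engine `FilteredConeFiModelRel`;
# RULING R15.39 (2) + ERRATUM 18:55:29Z + R15.48 (4) of res-L1-w45a-plan-1)

Support file for crux stmt-ResolutionOfSingularities-15315 (`FrobeniusLadder.FInjectiveMacaulayfication`), chain w45a, seat
res-L1-w45a-stub-1 g6. [OURS · L1 W4.5a; specimen = RGDD-L row F008 (res-L1-w45a-idea-2); singular locus and the three Fedder
coefficients machine-confirmed (kit j287843: minimal primes of `Jac(g₀)` over `𝔽₅` are `(t,z,y,x)` and `(x³+y², w, z)`; coefficients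
`w⁶`, `2x³yφ³`, `2t·x³yφ³` mod `5`); templates `GxzOffOrigin` (res-L1-w45a-stub-4) and `FedderViaSlicing(NotMem)` (stub-3 / stub-4)] —
NOT a statement of the manuscript [claim: Hironaka2017]; AI-written, weaker than expert review.

`g₀ = X₂² + X₄⁴X₃⁶ + (X₁² + X₀³)³ + X₄X₀³X₁X₃³` (`x,y,z,w,t = X₀,…,X₄`, `φ = X₁² + X₀³`) is the `(2,3,9,3 | 0)`-initial form of the
diagonalised row F008 (`…RelGddF008Data`).  In characteristic `5` its singular locus is `S ∪ W`,
`S = V(z, w, φ)` (the cusp surface, containing the `t`-axis `L`) and `W = V(x, y, z, t)` (the `w`-axis): all five partials in a prime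
`P ∋ g₀` force `P ⊇ (z, w, φ)` or `P ⊇ (x, y, z, t)`.  Off `L`:

* off `S ∪ W`: some partial `∉ P` ⇒ regular ⇒ clause (`ClauseOfPderivNotMem`);
* along `S ∖ L` (`x, y ∉ P`, `φ ∈ P`): if `t ∈ P`, PLANE SLICING `k[X] ≃ k[x,y][Z,W,T]` (`GxzOffOrigin.exists_planeSlicing5`), the
  `z⁴w³t`-coefficient of `g₀⁴` is `12·x³y·φ³` (`RelGddF008ConeData.coeff_along_S_plane`); if `t ∉ P`, the slicing
  `k[X] ≃ k[x,y,t][Z,W]` (`RelGddF008ConeData.exists_xytSlicing5`), the `z⁴w³`-coefficient of `g₀⁴` is `12·t·x³y·φ³`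
  (`coeff_along_S_xyt`); either way the point-unit variant `FedderViaSlicingNotMem.clause_of_sliceCoeff_of_not_mem` with
  `m = 3 ≤ p − 1` and `∂φ/∂y = 2y ∉ 𝔭` (transversal type `z² + φ³ + u·w³`);
* along `W ∖ 0` (`x, y, z, t ∈ P`, `w ∉ P`): the `w`-AXIS SLICING `k[X] ≃ k[w][x,y,z,t]` (`RelGddF008ConeData.exists_wAxisSlicing5`),
  the `x³y⁴z⁴t⁴`-coefficient of `g₀⁴` is `36·w⁶` (`coeff_along_W`), a unit at the point (`φ = 1`, `m = 0`; transversal type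
  `z² + w⁶t⁴ + (y² + x³)³ + w³·tx³y`, Fedder survivor `z⁴t⁴x³y⁴`).

Main theorem `g0_offL_clause_char5` = the hypothesis `hoff₀` of `FilteredConeFiModelRel.filteredConeFiModelRel_affineBlowup` for
`n = 5`, `J = {0,1,2,3}`, `p = 5`.  All proofs are glue on Mathlib and landed files; no definitions, no named facts. References:
[Fedder1983] R. Fedder, *F-purity and rational singularity*, Trans. AMS 278 (1983), Thm. 1.12 (through the imported criteria). [folklore]
-/

-- single-problem summit: the doubled namespace component is forced
set_option linter.dupNamespace false

noncomputable section

namespace Summit.ResolutionOfSingularities.ResolutionOfSingularities.Theorems.FInjectiveMacaulayfication.RelGddF008Cone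

open MvPolynomial IsLocalRing
open Summit.ResolutionOfSingularities.ResolutionOfSingularities.Theorems.FInjectiveMacaulayfication
open RelGddF008ConeData

/-! ## The cone clause off the `t`-axis -/

/-- **THE CONE CLAUSE `hoff₀` FOR `g₀ = z² + t⁴w⁶ + (y² + x³)³ + t·x³y·w³` AT `p = 5`**: at every maximal ideal `Q` of `k[X]/(g₀)`
missing some `x̄ⱼ`, `j ∈ {0,1,2,3}` (i.e. off the `t`-axis `L`), the local ring satisfies the Cohen–Macaulay + Frobenius-closed clause —
Jacobian off `S ∪ W`, Fedder through the plane / `(x,y,t)`-base slicings along the cusp surface `S ∖ L` (`12·x³y·φ³`, `12·t·x³y·φ³`,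
point-unit variant with `∂φ/∂y = 2y`) and through the `w`-axis slicing along `W ∖ 0` (`36·w⁶`). [cite: Fedder1983, Thm. 1.12]
[cite: Matsumura1987, Thm. 30.4 (ii)] -/
theorem g0_offL_clause_char5 (k : Type) [Field k] [CharP k 5] (g₀ : MvPolynomial (Fin 5) k)
    (hg : g₀ = X 2 ^ 2 + X 4 ^ 4 * X 3 ^ 6 + (X 1 ^ 2 + X 0 ^ 3) ^ 3 + X 4 * X 0 ^ 3 * X 1 * X 3 ^ 3) :
    ∀ (Q : Ideal (MvPolynomial (Fin 5) k ⧸ Ideal.span {g₀})) [Q.IsMaximal],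
      (∃ j ∈ ({0, 1, 2, 3} : Finset (Fin 5)), Ideal.Quotient.mk (Ideal.span {g₀}) (MvPolynomial.X j) ∉ Q) →
      ∀ d : ℕ, ringKrullDim (Localization.AtPrime Q) = d → ∀ s : Fin d → Localization.AtPrime Q,
        (Ideal.span (Set.range s)).radical.IsMaximal →
          RingTheory.Sequence.IsWeaklyRegular (Localization.AtPrime Q) (List.ofFn s) ∧
          ∀ y : Localization.AtPrime Q, (∃ e : ℕ, y ^ 5 ^ e ∈ Ideal.span
            ((fun z : Localization.AtPrime Q => z ^ 5 ^ e) ''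
              (Ideal.span (Set.range s) : Set (Localization.AtPrime Q)))) → y ∈ Ideal.span (Set.range s) := by
  haveI : Fact (Nat.Prime 5) := ⟨by norm_num⟩
  intro Q _ hj d hd s hs
  haveI hPmax : (Q.comap (Ideal.Quotient.mk (Ideal.span {g₀}))).IsMaximal :=
    Ideal.comap_isMaximal_of_surjective _ Ideal.Quotient.mk_surjective
  have hP := hPmax.isPrime
  have hg0 : g₀ ≠ 0 := hg ▸ RelGddF008Data.g0_ne_zero k
  -- `g₀ ∈ P`
  have hgP : g₀ ∈ Q.comap (Ideal.Quotient.mk (Ideal.span {g₀})) :=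
    Ideal.mem_comap.mpr (by
      rw [Ideal.Quotient.eq_zero_iff_mem.mpr (Ideal.mem_span_singleton_self g₀)]
      exact Q.zero_mem)
  -- units in characteristic `5`
  have hu2 : IsUnit (2 : MvPolynomial (Fin 5) k) := by simpa using G5wConeClause.isUnit_natCast_of_not_dvd 5 k 2 (by decide)
  have hu6 : IsUnit (6 : MvPolynomial (Fin 5) k) := by simpa using G5wConeClause.isUnit_natCast_of_not_dvd 5 k 6 (by decide)
  -- partial derivatives
  have hd0 : pderiv 0 g₀ = 9 * X 0 ^ 2 * (X 1 ^ 2 + X 0 ^ 3) ^ 2 + 3 * X 4 * X 0 ^ 2 * X 1 * X 3 ^ 3 := by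
    rw [hg, RelGddF008Data.pderiv_zero_g0]
  have hd1 : pderiv 1 g₀ = 6 * X 1 * (X 1 ^ 2 + X 0 ^ 3) ^ 2 + X 4 * X 0 ^ 3 * X 3 ^ 3 := by rw [hg, RelGddF008Data.pderiv_one_g0]
  have hd2 : pderiv 2 g₀ = 2 * X 2 := by rw [hg, RelGddF008Data.pderiv_two_g0]
  have hd3 : pderiv 3 g₀ = 6 * X 4 ^ 4 * X 3 ^ 5 + 3 * X 4 * X 0 ^ 3 * X 1 * X 3 ^ 2 := by rw [hg, RelGddF008Data.pderiv_three_g0]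
  have hd4 : pderiv 4 g₀ = 4 * X 4 ^ 3 * X 3 ^ 6 + X 0 ^ 3 * X 1 * X 3 ^ 3 := by rw [hg, RelGddF008Data.pderiv_four_g0]
  -- Jacobian exits
  by_cases m2 : pderiv 2 g₀ ∈ Q.comap (Ideal.Quotient.mk (Ideal.span {g₀})); swap
  · exact ClauseOfPderivNotMem.stub_clauseOfPderivNotMem 5 k 5 g₀ Q 2 m2 d hd s hs
  by_cases m3 : pderiv 3 g₀ ∈ Q.comap (Ideal.Quotient.mk (Ideal.span {g₀})); swap
  · exact ClauseOfPderivNotMem.stub_clauseOfPderivNotMem 5 k 5 g₀ Q 3 m3 d hd s hs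
  by_cases m4 : pderiv 4 g₀ ∈ Q.comap (Ideal.Quotient.mk (Ideal.span {g₀})); swap
  · exact ClauseOfPderivNotMem.stub_clauseOfPderivNotMem 5 k 5 g₀ Q 4 m4 d hd s hs
  by_cases m1 : pderiv 1 g₀ ∈ Q.comap (Ideal.Quotient.mk (Ideal.span {g₀})); swap
  · exact ClauseOfPderivNotMem.stub_clauseOfPderivNotMem 5 k 5 g₀ Q 1 m1 d hd s hs
  -- all (relevant) partials in `P`
  have hX2 : (X 2 : MvPolynomial (Fin 5) k) ∈ Q.comap (Ideal.Quotient.mk (Ideal.span {g₀})) := by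
    rw [hd2] at m2
    exact (Ideal.unit_mul_mem_iff_mem _ hu2).mp m2
  rw [hd3] at m3
  rw [hd4] at m4
  rw [hd1] at m1
  -- `φ ∈ P` as soon as `w ∈ P` or `t ∈ P` (`g₀ ≡ φ³` modulo `(z, w)` and modulo `(z, t)`)
  have hφ_of : (X 3 : MvPolynomial (Fin 5) k) ∈ Q.comap (Ideal.Quotient.mk (Ideal.span {g₀})) ∨
      (X 4 : MvPolynomial (Fin 5) k) ∈ Q.comap (Ideal.Quotient.mk (Ideal.span {g₀})) →
      (X 1 ^ 2 + X 0 ^ 3 : MvPolynomial (Fin 5) k) ∈ Q.comap (Ideal.Quotient.mk (Ideal.span {g₀})) := by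
    intro h
    refine hP.mem_of_pow_mem 3 ?_
    have e : ((X 1 ^ 2 + X 0 ^ 3) ^ 3 : MvPolynomial (Fin 5) k) =
        g₀ - X 2 * X 2 - X 3 * X 4 * (X 4 ^ 3 * X 3 ^ 5 + X 0 ^ 3 * X 1 * X 3 ^ 2) := by rw [hg]; ring
    rw [e]
    refine Ideal.sub_mem _ (Ideal.sub_mem _ hgP (Ideal.mul_mem_left _ _ hX2)) (Ideal.mul_mem_right _ _ ?_)
    rcases h with h | h
    · exact Ideal.mul_mem_right _ _ h
    · exact Ideal.mul_mem_left _ _ h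
  -- with `φ ∈ P`: `x ∈ P ↔ y ∈ P`
  have hxy : (X 1 ^ 2 + X 0 ^ 3 : MvPolynomial (Fin 5) k) ∈ Q.comap (Ideal.Quotient.mk (Ideal.span {g₀})) →
      ((X 0 : MvPolynomial (Fin 5) k) ∈ Q.comap (Ideal.Quotient.mk (Ideal.span {g₀})) ↔
        (X 1 : MvPolynomial (Fin 5) k) ∈ Q.comap (Ideal.Quotient.mk (Ideal.span {g₀}))) := by
    intro hφ
    constructor
    · intro h0
      refine hP.mem_of_pow_mem 2 ?_
      have e : (X 1 ^ 2 : MvPolynomial (Fin 5) k) = (X 1 ^ 2 + X 0 ^ 3) - X 0 * X 0 ^ 2 := by ring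
      rw [e]
      exact Ideal.sub_mem _ hφ (Ideal.mul_mem_right _ _ h0)
    · intro h1
      refine hP.mem_of_pow_mem 3 ?_
      have e : (X 0 ^ 3 : MvPolynomial (Fin 5) k) = (X 1 ^ 2 + X 0 ^ 3) - X 1 * X 1 := by ring
      rw [e]
      exact Ideal.sub_mem _ hφ (Ideal.mul_mem_right _ _ h1)
  -- not all of `x, y, z, w` lie in `P`
  have hnot : ¬ ((X 0 : MvPolynomial (Fin 5) k) ∈ Q.comap (Ideal.Quotient.mk (Ideal.span {g₀})) ∧
      (X 1 : MvPolynomial (Fin 5) k) ∈ Q.comap (Ideal.Quotient.mk (Ideal.span {g₀})) ∧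
      (X 3 : MvPolynomial (Fin 5) k) ∈ Q.comap (Ideal.Quotient.mk (Ideal.span {g₀}))) := by
    rintro ⟨h0, h1, h3⟩
    obtain ⟨j, hjJ, hj⟩ := hj
    apply hj
    simp only [Finset.mem_insert, Finset.mem_singleton] at hjJ
    rcases hjJ with rfl | rfl | rfl | rfl
    · exact Ideal.mem_comap.mp h0
    · exact Ideal.mem_comap.mp h1
    · exact Ideal.mem_comap.mp hX2
    · exact Ideal.mem_comap.mp h3
  by_cases hX3 : (X 3 : MvPolynomial (Fin 5) k) ∈ Q.comap (Ideal.Quotient.mk (Ideal.span {g₀}))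
  · /- CASE `S`: `w ∈ P` ⇒ `φ ∈ P`, and then `x, y ∉ P` -/
    have hφ := hφ_of (Or.inl hX3)
    have hX0 : (X 0 : MvPolynomial (Fin 5) k) ∉ Q.comap (Ideal.Quotient.mk (Ideal.span {g₀})) :=
      fun h0 => hnot ⟨h0, (hxy hφ).mp h0, hX3⟩
    have hX1 : (X 1 : MvPolynomial (Fin 5) k) ∉ Q.comap (Ideal.Quotient.mk (Ideal.span {g₀})) :=
      fun h1 => hnot ⟨(hxy hφ).mpr h1, h1, hX3⟩
    by_cases hX4 : (X 4 : MvPolynomial (Fin 5) k) ∈ Q.comap (Ideal.Quotient.mk (Ideal.span {g₀}))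
    · /- `t ∈ P`: the plane slicing (base `k[x,y]`; slices `z, w, t`) -/
      obtain ⟨Ψ, hΨ0, hΨ1, hΨ2, hΨ3, hΨ4⟩ := GxzOffOrigin.exists_planeSlicing5 k
      have hy0 : Ψ.symm (X 0) = X 2 := Ψ.symm_apply_eq.mpr hΨ2.symm
      have hy1 : Ψ.symm (X 1) = X 3 := Ψ.symm_apply_eq.mpr hΨ3.symm
      have hy2 : Ψ.symm (X 2) = X 4 := Ψ.symm_apply_eq.mpr hΨ4.symm
      have hb0 : Ψ.symm (C (X 0)) = X 0 := Ψ.symm_apply_eq.mpr hΨ0.symm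
      have hb1 : Ψ.symm (C (X 1)) = X 1 := Ψ.symm_apply_eq.mpr hΨ1.symm
      have hy : ∀ r : Fin 3, Ψ.symm (X r) ∈ Q.comap (Ideal.Quotient.mk (Ideal.span {g₀})) := by
        intro r
        fin_cases r
        · exact hy0 ▸ hX2
        · exact hy1 ▸ hX3
        · exact hy2 ▸ hX4
      have hΨg : Ψ g₀ = X 0 ^ 2 + (X 2 ^ 4 * X 1 ^ 6 + C (X 1 ^ 2 + X 0 ^ 3) ^ 3 + C (X 0 ^ 3 * X 1) * X 2 * X 1 ^ 3) := by
        rw [hg]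
        simp only [map_add, map_mul, map_pow, hΨ0, hΨ1, hΨ2, hΨ3, hΨ4]
        ring
      have hcoeff : coeff (Finsupp.single (0 : Fin 3) (2 * 2) + (Finsupp.single 1 3 + Finsupp.single 2 1)) (Ψ (g₀ ^ (5 - 1))) =
          (12 * (X 0 ^ 3 * X 1)) * (X 1 ^ 2 + X 0 ^ 3) ^ 3 := by
        rw [map_pow, hΨg, show (5 - 1 : ℕ) = 4 from rfl, coeff_along_S_plane]
      have hdslice : ∀ r : Fin 3, (Finsupp.single (0 : Fin 3) (2 * 2) + (Finsupp.single 1 3 + Finsupp.single 2 1) : Fin 3 →₀ ℕ) r < 5 := by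
        intro r
        fin_cases r <;> simp
      haveI h𝔭 : ((Q.comap (Ideal.Quotient.mk (Ideal.span {g₀}))).comap (Ψ.symm.toRingHom.comp C)).IsPrime :=
        Ideal.comap_isPrime _ _
      -- `12x³y ∉ 𝔭`
      have hu : (12 * (X 0 ^ 3 * X 1) : MvPolynomial (Fin 2) k) ∉
          (Q.comap (Ideal.Quotient.mk (Ideal.span {g₀}))).comap (Ψ.symm.toRingHom.comp C) := by
        intro h12
        have hu12 : IsUnit (12 : MvPolynomial (Fin 2) k) := by
          simpa using G5wConeClause.isUnit_natCast_of_not_dvd 5 k 12 (by decide)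
        rcases h𝔭.mem_or_mem ((Ideal.unit_mul_mem_iff_mem _ hu12).mp h12) with h | h
        · have h1 := Ideal.mem_comap.mp (h𝔭.mem_of_pow_mem 3 h)
          rw [RingHom.comp_apply, RingEquiv.toRingHom_eq_coe, RingEquiv.coe_toRingHom, hb0] at h1
          exact hX0 h1
        · have h1 := Ideal.mem_comap.mp h
          rw [RingHom.comp_apply, RingEquiv.toRingHom_eq_coe, RingEquiv.coe_toRingHom, hb1] at h1
          exact hX1 h1
      -- `∂φ/∂y = 2y ∉ 𝔭`
      have hdn : pderiv 1 (X 1 ^ 2 + X 0 ^ 3 : MvPolynomial (Fin 2) k) ∉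
          (Q.comap (Ideal.Quotient.mk (Ideal.span {g₀}))).comap (Ψ.symm.toRingHom.comp C) := by
        have e : pderiv 1 (X 1 ^ 2 + X 0 ^ 3 : MvPolynomial (Fin 2) k) = 2 * X 1 := by
          simp only [map_add, pderiv_pow, pderiv_X_self, pderiv_X_of_ne (show (0 : Fin 2) ≠ 1 by decide)]
          norm_num
        rw [e]
        intro h2
        have hu2' : IsUnit (2 : MvPolynomial (Fin 2) k) := by simpa using G5wConeClause.isUnit_natCast_of_not_dvd 5 k 2 (by decide)
        have h1 := Ideal.mem_comap.mp ((Ideal.unit_mul_mem_iff_mem _ hu2').mp h2)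
        rw [RingHom.comp_apply, RingEquiv.toRingHom_eq_coe, RingEquiv.coe_toRingHom, hb1] at h1
        exact hX1 h1
      exact FedderViaSlicingNotMem.clause_of_sliceCoeff_of_not_mem 5 k Ψ g₀ hg0 Q hy _ hdslice _ (X 1 ^ 2 + X 0 ^ 3) hu 3
        (by norm_num) hcoeff (Or.inr ⟨1, hdn⟩) d hd s hs
    · /- `t ∉ P`: the `(x,y,t)`-base slicing (slices `z, w`) -/
      obtain ⟨Ψ, hΨ0, hΨ1, hΨ2, hΨ3, hΨ4⟩ := exists_xytSlicing5 k
      have hy0 : Ψ.symm (X 0) = X 2 := Ψ.symm_apply_eq.mpr hΨ2.symm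
      have hy1 : Ψ.symm (X 1) = X 3 := Ψ.symm_apply_eq.mpr hΨ3.symm
      have hb0 : Ψ.symm (C (X 0)) = X 0 := Ψ.symm_apply_eq.mpr hΨ0.symm
      have hb1 : Ψ.symm (C (X 1)) = X 1 := Ψ.symm_apply_eq.mpr hΨ1.symm
      have hb2 : Ψ.symm (C (X 2)) = X 4 := Ψ.symm_apply_eq.mpr hΨ4.symm
      have hy : ∀ r : Fin 2, Ψ.symm (X r) ∈ Q.comap (Ideal.Quotient.mk (Ideal.span {g₀})) := by
        intro r
        fin_cases r
        · exact hy0 ▸ hX2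
        · exact hy1 ▸ hX3
      have hΨg : Ψ g₀ = X 0 ^ 2 + (C (X 2 ^ 4) * X 1 ^ 6 + C (X 1 ^ 2 + X 0 ^ 3) ^ 3 + C (X 2 * X 0 ^ 3 * X 1) * X 1 ^ 3) := by
        rw [hg]
        simp only [map_add, map_mul, map_pow, hΨ0, hΨ1, hΨ2, hΨ3, hΨ4]
        ring
      have hcoeff : coeff (Finsupp.single (0 : Fin 2) (2 * 2) + Finsupp.single 1 3) (Ψ (g₀ ^ (5 - 1))) =
          (12 * (X 2 * X 0 ^ 3 * X 1)) * (X 1 ^ 2 + X 0 ^ 3) ^ 3 := by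
        rw [map_pow, hΨg, show (5 - 1 : ℕ) = 4 from rfl, coeff_along_S_xyt]
      have hdslice : ∀ r : Fin 2, (Finsupp.single (0 : Fin 2) (2 * 2) + Finsupp.single 1 3 : Fin 2 →₀ ℕ) r < 5 := by
        intro r
        fin_cases r <;> simp
      haveI h𝔭 : ((Q.comap (Ideal.Quotient.mk (Ideal.span {g₀}))).comap (Ψ.symm.toRingHom.comp C)).IsPrime :=
        Ideal.comap_isPrime _ _
      -- `12·t·x³y ∉ 𝔭`
      have hu : (12 * (X 2 * X 0 ^ 3 * X 1) : MvPolynomial (Fin 3) k) ∉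
          (Q.comap (Ideal.Quotient.mk (Ideal.span {g₀}))).comap (Ψ.symm.toRingHom.comp C) := by
        intro h12
        have hu12 : IsUnit (12 : MvPolynomial (Fin 3) k) := by
          simpa using G5wConeClause.isUnit_natCast_of_not_dvd 5 k 12 (by decide)
        rcases h𝔭.mem_or_mem ((Ideal.unit_mul_mem_iff_mem _ hu12).mp h12) with h | h
        · rcases h𝔭.mem_or_mem h with h | h
          · have h1 := Ideal.mem_comap.mp h
            rw [RingHom.comp_apply, RingEquiv.toRingHom_eq_coe, RingEquiv.coe_toRingHom, hb2] at h1
            exact hX4 h1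
          · have h1 := Ideal.mem_comap.mp (h𝔭.mem_of_pow_mem 3 h)
            rw [RingHom.comp_apply, RingEquiv.toRingHom_eq_coe, RingEquiv.coe_toRingHom, hb0] at h1
            exact hX0 h1
        · have h1 := Ideal.mem_comap.mp h
          rw [RingHom.comp_apply, RingEquiv.toRingHom_eq_coe, RingEquiv.coe_toRingHom, hb1] at h1
          exact hX1 h1
      have hdn : pderiv 1 (X 1 ^ 2 + X 0 ^ 3 : MvPolynomial (Fin 3) k) ∉
          (Q.comap (Ideal.Quotient.mk (Ideal.span {g₀}))).comap (Ψ.symm.toRingHom.comp C) := by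
        have e : pderiv 1 (X 1 ^ 2 + X 0 ^ 3 : MvPolynomial (Fin 3) k) = 2 * X 1 := by
          simp only [map_add, pderiv_pow, pderiv_X_self, pderiv_X_of_ne (show (0 : Fin 3) ≠ 1 by decide)]
          norm_num
        rw [e]
        intro h2
        have hu2' : IsUnit (2 : MvPolynomial (Fin 3) k) := by simpa using G5wConeClause.isUnit_natCast_of_not_dvd 5 k 2 (by decide)
        have h1 := Ideal.mem_comap.mp ((Ideal.unit_mul_mem_iff_mem _ hu2').mp h2)
        rw [RingHom.comp_apply, RingEquiv.toRingHom_eq_coe, RingEquiv.coe_toRingHom, hb1] at h1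
        exact hX1 h1
      exact FedderViaSlicingNotMem.clause_of_sliceCoeff_of_not_mem 5 k Ψ g₀ hg0 Q hy _ hdslice _ (X 1 ^ 2 + X 0 ^ 3) hu 3
        (by norm_num) hcoeff (Or.inr ⟨1, hdn⟩) d hd s hs
  · /- CASE `W`: `w ∉ P` ⇒ `t ∈ P` (from `∂₃, ∂₄`), `φ ∈ P`, `x, y ∈ P` -/
    -- `A₀ := 4t³w³ + x³y ∈ P` from `∂₄ = w³·A₀`
    have hA : (4 * X 4 ^ 3 * X 3 ^ 3 + X 0 ^ 3 * X 1 : MvPolynomial (Fin 5) k) ∈ Q.comap (Ideal.Quotient.mk (Ideal.span {g₀})) := by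
      have e : (4 * X 4 ^ 3 * X 3 ^ 6 + X 0 ^ 3 * X 1 * X 3 ^ 3 : MvPolynomial (Fin 5) k) =
          X 3 ^ 3 * (4 * X 4 ^ 3 * X 3 ^ 3 + X 0 ^ 3 * X 1) := by ring
      rw [e] at m4
      rcases hP.mem_or_mem m4 with h | h
      · exact absurd (hP.mem_of_pow_mem 3 h) hX3
      · exact h
    -- `t ∈ P` from `∂₃ = w²·t·(6t³w³ + 3x³y)` and `A₀`
    have hX4 : (X 4 : MvPolynomial (Fin 5) k) ∈ Q.comap (Ideal.Quotient.mk (Ideal.span {g₀})) := by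
      by_contra h4
      have e : (6 * X 4 ^ 4 * X 3 ^ 5 + 3 * X 4 * X 0 ^ 3 * X 1 * X 3 ^ 2 : MvPolynomial (Fin 5) k) =
          X 3 ^ 2 * (X 4 * (6 * X 4 ^ 3 * X 3 ^ 3 + 3 * X 0 ^ 3 * X 1)) := by ring
      rw [e] at m3
      rcases hP.mem_or_mem m3 with h | h
      · exact hX3 (hP.mem_of_pow_mem 2 h)
      rcases hP.mem_or_mem h with h | hB
      · exact h4 h
      -- `3·A₀ − B₀ = 6t³w³`
      have h6 : (6 * (X 4 ^ 3 * X 3 ^ 3) : MvPolynomial (Fin 5) k) ∈ Q.comap (Ideal.Quotient.mk (Ideal.span {g₀})) := by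
        have e2 : (6 * (X 4 ^ 3 * X 3 ^ 3) : MvPolynomial (Fin 5) k) =
            3 * (4 * X 4 ^ 3 * X 3 ^ 3 + X 0 ^ 3 * X 1) - (6 * X 4 ^ 3 * X 3 ^ 3 + 3 * X 0 ^ 3 * X 1) := by ring
        rw [e2]
        exact Ideal.sub_mem _ (Ideal.mul_mem_left _ _ hA) hB
      rcases hP.mem_or_mem ((Ideal.unit_mul_mem_iff_mem _ hu6).mp h6) with h | h
      · exact h4 (hP.mem_of_pow_mem 3 h)
      · exact hX3 (hP.mem_of_pow_mem 3 h)
    have hφ := hφ_of (Or.inr hX4)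
    -- `x³y = A₀ − 4t³w³ ∈ P` ⇒ `x ∈ P` and `y ∈ P`
    have hx3y : (X 0 ^ 3 * X 1 : MvPolynomial (Fin 5) k) ∈ Q.comap (Ideal.Quotient.mk (Ideal.span {g₀})) := by
      have e : (X 0 ^ 3 * X 1 : MvPolynomial (Fin 5) k) = (4 * X 4 ^ 3 * X 3 ^ 3 + X 0 ^ 3 * X 1) - X 4 * (4 * X 4 ^ 2 * X 3 ^ 3) := by
        ring
      rw [e]
      exact Ideal.sub_mem _ hA (Ideal.mul_mem_right _ _ hX4)
    have hX0 : (X 0 : MvPolynomial (Fin 5) k) ∈ Q.comap (Ideal.Quotient.mk (Ideal.span {g₀})) := by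
      rcases hP.mem_or_mem hx3y with h | h
      · exact hP.mem_of_pow_mem 3 h
      · exact (hxy hφ).mpr h
    have hX1 : (X 1 : MvPolynomial (Fin 5) k) ∈ Q.comap (Ideal.Quotient.mk (Ideal.span {g₀})) := (hxy hφ).mp hX0
    -- the `w`-axis slicing (base `k[w]`; slices `x, y, z, t`)
    obtain ⟨Ψ, hΨ0, hΨ1, hΨ2, hΨ3, hΨ4⟩ := exists_wAxisSlicing5 k
    have hy0 : Ψ.symm (X 0) = X 0 := Ψ.symm_apply_eq.mpr hΨ0.symm
    have hy1 : Ψ.symm (X 1) = X 1 := Ψ.symm_apply_eq.mpr hΨ1.symm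
    have hy2 : Ψ.symm (X 2) = X 2 := Ψ.symm_apply_eq.mpr hΨ2.symm
    have hy3 : Ψ.symm (X 3) = X 4 := Ψ.symm_apply_eq.mpr hΨ4.symm
    have hb0 : Ψ.symm (C (X 0)) = X 3 := Ψ.symm_apply_eq.mpr hΨ3.symm
    have hy : ∀ r : Fin 4, Ψ.symm (X r) ∈ Q.comap (Ideal.Quotient.mk (Ideal.span {g₀})) := by
      intro r
      fin_cases r
      · exact hy0 ▸ hX0
      · exact hy1 ▸ hX1
      · exact hy2 ▸ hX2
      · exact hy3 ▸ hX4
    have hΨg : Ψ g₀ = X 2 ^ 2 + (C (X 0) ^ 6 * X 3 ^ 4 + (X 1 ^ 2 + X 0 ^ 3) ^ 3 + C (X 0) ^ 3 * X 3 * X 0 ^ 3 * X 1) := by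
      rw [hg]
      simp only [map_add, map_mul, map_pow, hΨ0, hΨ1, hΨ2, hΨ3, hΨ4]
      ring
    have hcoeff : coeff (Finsupp.single (2 : Fin 4) (2 * 2) + (Finsupp.single 3 4 + Finsupp.single 0 3 + Finsupp.single 1 4))
        (Ψ (g₀ ^ (5 - 1))) = (36 * X 0 ^ 6) * (1 : MvPolynomial (Fin 1) k) ^ 0 := by
      rw [map_pow, hΨg, show (5 - 1 : ℕ) = 4 from rfl, coeff_along_W, pow_zero, mul_one]
    have hdslice : ∀ r : Fin 4, (Finsupp.single (2 : Fin 4) (2 * 2) + (Finsupp.single 3 4 + Finsupp.single 0 3 + Finsupp.single 1 4) :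
        Fin 4 →₀ ℕ) r < 5 := by
      intro r
      fin_cases r <;> simp
    haveI h𝔭 : ((Q.comap (Ideal.Quotient.mk (Ideal.span {g₀}))).comap (Ψ.symm.toRingHom.comp C)).IsPrime :=
      Ideal.comap_isPrime _ _
    -- `36w⁶ ∉ 𝔭`
    have hu : (36 * X 0 ^ 6 : MvPolynomial (Fin 1) k) ∉
        (Q.comap (Ideal.Quotient.mk (Ideal.span {g₀}))).comap (Ψ.symm.toRingHom.comp C) := by
      intro h36
      have hu36 : IsUnit (36 : MvPolynomial (Fin 1) k) := by
        simpa using G5wConeClause.isUnit_natCast_of_not_dvd 5 k 36 (by decide)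
      have h1 := Ideal.mem_comap.mp (h𝔭.mem_of_pow_mem 6 ((Ideal.unit_mul_mem_iff_mem _ hu36).mp h36))
      rw [RingHom.comp_apply, RingEquiv.toRingHom_eq_coe, RingEquiv.coe_toRingHom, hb0] at h1
      exact hX3 h1
    have h1 : (1 : MvPolynomial (Fin 1) k) ∉ (Q.comap (Ideal.Quotient.mk (Ideal.span {g₀}))).comap (Ψ.symm.toRingHom.comp C) :=
      (Ideal.ne_top_iff_one _).mp h𝔭.ne_top
    exact FedderViaSlicingNotMem.clause_of_sliceCoeff_of_not_mem 5 k Ψ g₀ hg0 Q hy _ hdslice _ 1 hu 0 (by norm_num) hcoeff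
      (Or.inl h1) d hd s hs

end Summit.ResolutionOfSingularities.ResolutionOfSingularities.Theorems.FInjectiveMacaulayfication.RelGddF008Cone

end
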